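import Mathlib
import Literature.MathematicalPhysics.QuantumFieldTheory.Balaban1983to89.T4CubeShellProfileP


/-!
# Cube-shell conditioning IX: the GRADIENT-PARTNER profile `κ^∂_P ≤ κ_P` — the recursion of modules VII ∕ VIII only
consumes the covariances of the conditional children with the normalised FROZEN-DIRECTION partials
`C⁻¹·(∂_j f₁) ∘ merge`, so the barrier closes from ONE seed on those covariances ALONE

Landing edition «CubeShell IX» of the ideation cell `ym-nodeO-ideate` (seat P1, lens «inside Bałaban»; memo
`memos/ROUTE-P1.md` §0y.40, companion 45 `memos/ROUTE-P1-SketchCubeShellIX.lean`), over the landed modules VII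
`T4CubeShellProfile` (seat P8) and VIII `T4CubeShellProfileP` (this seat) of this directory.  It sharpens WHAT THE SEED
MUST BOUND.  Module VII's admissible triples `Spec.Adm m f F H` (and so the profiles `κ = Spec.kappa`, `κ_P = kappaP`) range
over ALL pairs of `C¹` inserts with `|∇F|, |∇H| ≤ 1` supported at mutual distance `> m`; but the proof of the one-sided
recursion bound `Spec.side_bound` (VII) ∕ `side_boundP` (VIII) only ever evaluates the profile on the CHILD TRIPLES
— potential `condPot lab λ f₁ x` (the regularised conditional potential of module IV at a boundary field `x` IN THE
WINDOW), insert `F ∘ merge lab x`, and partner `z ↦ C⁻¹ · ∂_j f₁ (merge lab x z)`, the normalised partial of the parent's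
one-sided piece in ONE FROZEN shell direction `j` as a function of the free spins in `B_r(j)` — through module IV's
identification `shellCov_grad_eq_cubeCov_condPot`.  Sorry-free; no `axiom`; no `instance`; no notation; everything of
modules I ∕ IV ∕ V ∕ VII ∕ VIII BY NAME, nothing restated.

WHAT IS TYPED HERE (same printed ingredients as VII ∕ VIII — Brascamp–Lieb [BrascampLieb1976, Thm 4.1], the DLR ∕
specification structure of finite-range Gibbs measures [FriedliVelenik2017, Lemma 6.7 (6.7)–(6.10), §6.10.1 (6.110)], the
Cauchy–Schwarz doubling of module V, the covariance-as-derivative identity [GlimmJaffe1987, Cor. 4.3.4 (proof)]):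
* §1 for a predicate `P` on potentials, the GRADIENT-PARTNER PROFILE `kappaD 𝔖 P m` (`κ^∂_P(m)`) = the supremum (`0`
  adjoined) of `|cubeCov (condPot lab λ f₁ x) S (F ∘ merge lab x) (C⁻¹·(∂_j f₁) ∘ merge lab x)|` over one-sided data
  `Spec.SideData lab f f₁ f₂ C`, boundary fields `x ∈ [-S,S]ⁿ`, shell sites `j`, inserts `F` on `A ⊆ inside` with
  `d(A, j) > m + r`, such that the child potential satisfies `P`; `adm_child`: every such child triple IS admissible at
  level `m` (the first half of VII's proof of `side_bound`, isolated), whence `profileSetD ⊆ profileSetP` and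
  `0 ≤ κ^∂_P ≤ κ_P`; least-bound form `kappaD_le_of_forall`; monotone in `P`, antitone in `m`;
* §2 `side_boundD`: along one-sided data, if the children satisfy `P`, every shell-indexed conditional covariance is
  `≤ C · κ^∂_P(m)` (by DEFINITION of `κ^∂_P` + the identification + rescaling by `C`); `kappaP_stepD`: for closed `P` and
  `M > 2m + 3r`, `κ_P(M) ≤ λ⁻¹ · (a · G(m + 2r)) · 2R² · κ^∂_P(m)²` — the FULL relative profile at the coarse scale from the
  GRADIENT-PARTNER profile at the fine scale (VIII's `kappaP_step` with `side_boundD` on both sides);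
* §3 `kappaD_barrier`: along `s_{j+1} = 2 s_j + 3r + 1` with `a·G(s_j + 2r) ≤ A q^j`, ONE seed `c A q κ^∂_P(s_0) ≤ ρ`
  (`c = Spec.cst = 2R²∕λ`) gives `κ^∂_P(s_j) ≤ ρ^{2^j} ∕ (c A q^{j+1})` for all `j` (since
  `κ^∂_P(s_{j+1}) ≤ κ_P(s_{j+1}) ≤ c A q^j κ^∂_P(s_j)²`, VII's `sq_barrier`); `kappaP_barrier_of_gradSeed(_of_le)`: the full
  relative profile `κ_P(m) ≤ ρ^{2^{j+1}} ∕ (c A q^{j+2})` for `m ≥ s_{j+1}`; `kappaD_seed_of_forall` spells the seed out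
  pointwise; `gradSeed_of_seed`: VIII's seed implies this one (never conversely);
* §4 read-outs for ONE action `f₀` with `P f₀`, `P` closed (`abs_cubeCov_le_of_closed_gradSeed`), and in the near-Gaussian
  class `𝔐_ε = NearGauss 𝔖 ε` of module VIII §6 (`abs_cubeCov_le_of_nearGauss_gradSeed`).
So an in-situ seed need only bound child covariances whose far partner is the partial of the parent potential at ONE
frozen site as a function of the nearby free spins (near-affine in `𝔐_ε`: Hessian rows of oscillation `≤ ε`) — the shape
in which an integration by parts on the window with boundary faces (module `T4CubeShellResponseStein` of this directory)
followed by a Combes–Thomas estimate for a banded positive matrix would apply — and NOT the covariances of two general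
Lipschitz inserts (for which the printed full-space route is the Helffer–Sjöstrand representation [HelfferSjostrand1994],
[Ledoux2001, Prop. 6.2 p.190]).
WHAT THIS FILE DOES NOT CLAIM.  (i) No seed is proved here — on `κ`, `κ_P` or `κ^∂_P` it is a HYPOTHESIS; no integration
by parts and no Combes–Thomas estimate is carried out in this file, and the seed over `𝔐_ε` of §4 is NOT proved; (ii) it is
NOT shown that any effective action of a renormalisation programme (extended off the window) lies in some `𝔐_ε` (the bound
`RowOsc` of module VIII is GLOBAL — window caveat); (iii) nothing here is an estimate on any density of Bałaban's programme,
nor a statement about [Balaban1987RG1] Thm 2 ∕ (0.31), nor about the cell's target (an inhabitant of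
`B13TermWalkDataOneTorus.ExistsUniformAcrossSmall`): the model is the WINDOWED cube model with a GLOBAL Hessian bound and
FINITE range.  Proofs ours; cite tags name the printed sources of the ingredients ∕ the printed analogue.
-/

set_option autoImplicit false
namespace Literature.MathematicalPhysics.QuantumFieldTheory.Balaban1983to89.T4CubeShellGradPartner

open MeasureTheory Set Matrix
open Literature.MathematicalPhysics.QuantumFieldTheory.Balaban1983to89.T4CubeShellConditional
open Literature.MathematicalPhysics.QuantumFieldTheory.Balaban1983to89.T4CubeShellDoubling
open Literature.MathematicalPhysics.QuantumFieldTheory.Balaban1983to89.T4CubePoincare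
open Literature.MathematicalPhysics.QuantumFieldTheory.Balaban1983to89.T4CubeShellBlocks
open Literature.MathematicalPhysics.QuantumFieldTheory.Balaban1983to89.T4CubeShellProfile
open Literature.MathematicalPhysics.QuantumFieldTheory.Balaban1983to89.T4CubeShellProfileP
open Literature.Probability.Distributions

variable {n : ℕ}

/-! ## §1 The gradient-partner profile `κ^∂_P` of a sub-class `P`; the child triples are admissible -/

section ProfileD

variable (𝔖 : Spec n) (P : ((Fin n → ℝ) → ℝ) → Prop)

/-- The set of GRADIENT-PARTNER covariance values at separation `m` relative to `P` (with `0` adjoined): the cube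
covariances of the CHILD TRIPLES of module VII's one-sided recursion bound `side_bound` — potential `condPot lab λ f₁ x`,
insert `F ∘ merge lab x`, partner `z ↦ C⁻¹ · ∂_j f₁ (merge lab x z)` — over one-sided data `(lab, f, f₁, f₂, C)`, boundary
fields `x` IN THE WINDOW, shell coordinates `j` (`lab j = 1`), inserts `F` supported in `A ⊆ inside` with
`d(A, j) > m + r`, SUCH THAT the child potential satisfies `P`.  The partner is the normalised partial of the parent's
one-sided piece in the FROZEN shell direction `j`, as a function of the inside coordinates (it depends on `B_r(j)` only);
for a parent with nearly constant Hessian rows it is an affine function plus a remainder with small gradient.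
[cite: Martinelli1999, §2.4 p.103 (Def. 2.6); FriedliVelenik2017, Lemma 6.7 (6.7); GlimmJaffe1987, Cor. 4.3.4 (proof)] -/
def profileSetD (m : ℕ) : Set ℝ :=
  {t | t = 0 ∨ ∃ (lab : Fin n → Fin 3) (f f₁ f₂ : (Fin n → ℝ) → ℝ) (C : ℝ) (x : Fin n → ℝ) (j : Fin n)
      (F : (Fin n → ℝ) → ℝ) (A : Finset (Fin n)),
      𝔖.SideData lab f f₁ f₂ C ∧ x ∈ cube n 𝔖.S ∧ lab j = 1 ∧ P (condPot lab 𝔖.lam f₁ x) ∧ 𝔖.Obs F A ∧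
        (∀ i ∈ A, lab i = 0) ∧ (∀ i ∈ A, m + 𝔖.r < 𝔖.d i j) ∧
        t = |cubeCov (condPot lab 𝔖.lam f₁ x) 𝔖.S (fun z => F (merge lab x z))
              (fun z => C⁻¹ * coordGradient f₁ (merge lab x z) j)|}

/-- THE GRADIENT-PARTNER PROFILE `κ^∂_P(m) := sup profileSetD 𝔖 P m` — the supremum of the child covariances with
frozen-direction gradient partners at separation `m`, relative to `P`. [cite: Martinelli1999, §2.4 p.103 (Def. 2.6); GlimmJaffe1987, Cor. 4.3.4 (proof)] -/
noncomputable def kappaD (m : ℕ) : ℝ := sSup (profileSetD 𝔖 P m)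

/-- `0` is adjoined. [cite: Martinelli1999, §2.4 p.103 (Def. 2.6)] -/
theorem zero_mem_profileSetD (m : ℕ) : (0 : ℝ) ∈ profileSetD 𝔖 P m := Or.inl rfl

/-- The gradient-partner profile set is nonempty. [cite: Martinelli1999, §2.4 p.103 (Def. 2.6)] -/
theorem profileSetD_nonempty (m : ℕ) : (profileSetD 𝔖 P m).Nonempty := ⟨0, zero_mem_profileSetD 𝔖 P m⟩

/-- **The child triple of the one-sided recursion bound is ADMISSIBLE AT LEVEL `m`** (the first half of module VII's proof of
`side_bound`, isolated): the regularised conditional potential is in `𝔐` (`inClass_condPot`), `F ∘ merge` is an insert on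
`A`, the normalised frozen-direction partial `C⁻¹·(∂_j f₁) ∘ merge` is an insert on `B_r(j)`, and `d(A, B_r(j)) > m`.
[cite: BrascampLieb1976, Thm 4.1; FriedliVelenik2017, Lemma 6.7 (6.7); FriedliVelenik2017, §6.10.1 (6.110); Martinelli1999, §2.4 p.103 (Def. 2.6)] -/
theorem adm_child {lab : Fin n → Fin 3} {f f₁ f₂ : (Fin n → ℝ) → ℝ} {C : ℝ} (hD : 𝔖.SideData lab f f₁ f₂ C)
    (x : Fin n → ℝ) {j : Fin n} (hj : lab j = 1) {m : ℕ} {F : (Fin n → ℝ) → ℝ} {A : Finset (Fin n)}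
    (hF : 𝔖.Obs F A) (hA1 : ∀ i ∈ A, m + 𝔖.r < 𝔖.d i j) :
    𝔖.Adm m (condPot lab 𝔖.lam f₁ x) (fun z => F (merge lab x z))
      (fun z => C⁻¹ * coordGradient f₁ (merge lab x z) j) := by
  obtain ⟨hFc, hF1, hFd, hAcard⟩ := hF
  have hC : C ≠ 0 := hD.C_pos.ne'
  have hm1 : ContDiff ℝ 1 (merge lab x) := contDiff_merge_right lab x
  have hdj : ContDiff ℝ 1 (fun y => coordGradient f₁ y j) := contDiff_one_coordGradient hD.cd₁ j
  have hdjm : Differentiable ℝ (fun z => coordGradient f₁ (merge lab x z) j) :=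
    (hdj.differentiable one_ne_zero).comp (hm1.differentiable one_ne_zero)
  have hF' : 𝔖.Obs (fun z => F (merge lab x z)) A :=
    ⟨hFc.comp hm1, fun z => (gradSq_comp_merge_le lab (hFc.differentiable one_ne_zero) x z).trans (hF1 _),
      dependsOn_comp_merge_right lab x hFd, hAcard⟩
  have hG' : 𝔖.Obs (fun z => C⁻¹ * coordGradient f₁ (merge lab x z) j) (𝔖.ball 𝔖.r j) := by
    refine ⟨contDiff_const.mul (hdj.comp hm1), fun z => ?_,
      dependsOn_const_mul (dependsOn_comp_merge_right lab x (hD.shell_dep j hj)) C⁻¹, 𝔖.card_ball_le_a j⟩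
    rw [gradSq_const_mul hdjm C⁻¹ z]
    have h := (gradSq_comp_merge_le lab (Φ := fun y => coordGradient f₁ y j) (hdj.differentiable one_ne_zero)
      x z).trans (hD.shell_row j hj _)
    calc C⁻¹ ^ 2 * (coordGradient (fun z => coordGradient f₁ (merge lab x z) j) z
            ⬝ᵥ coordGradient (fun z => coordGradient f₁ (merge lab x z) j) z)
        ≤ C⁻¹ ^ 2 * C ^ 2 := by gcongr
      _ = 1 := by field_simp
  have hsep : ∀ i ∈ A, ∀ k ∈ 𝔖.ball 𝔖.r j, m < 𝔖.d i k := by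
    intro i hi k hk
    have h1 := hA1 i hi
    have h2 := 𝔖.mem_ball.mp hk
    have h3 := 𝔖.d_tri i k j
    omega
  exact ⟨𝔖.inClass_condPot hD x, A, 𝔖.ball 𝔖.r j, hF', hG', hsep⟩

/-- Every gradient-partner covariance value is a relative profile value: `profileSetD ⊆ profileSetP` (the child triple is
admissible at level `m` and its potential satisfies `P`). [cite: Martinelli1999, §2.4 p.103 (Def. 2.6)] -/
theorem profileSetD_subset (m : ℕ) : profileSetD 𝔖 P m ⊆ profileSetP 𝔖 P m := by
  rintro t (rfl | ⟨lab, f, f₁, f₂, C, x, j, F, A, hD, -, hj, hPc, hF, -, hA1, rfl⟩)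
  · exact zero_mem_profileSetP 𝔖 P m
  · exact Or.inr ⟨_, _, _, adm_child 𝔖 hD x hj hF hA1, hPc, rfl⟩

/-- The gradient-partner profile set is bounded above (by `λ⁻¹`, through `profileSetP`). [cite: BrascampLieb1976, Thm 4.1] -/
theorem profileSetD_bddAbove (m : ℕ) : BddAbove (profileSetD 𝔖 P m) :=
  (profileSetP_bddAbove 𝔖 P m).mono (profileSetD_subset 𝔖 P m)

/-- `0 ≤ κ^∂_P(m)`. [cite: Martinelli1999, §2.4 p.103 (Def. 2.6)] -/
theorem kappaD_nonneg (m : ℕ) : 0 ≤ kappaD 𝔖 P m :=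
  le_csSup (profileSetD_bddAbove 𝔖 P m) (zero_mem_profileSetD 𝔖 P m)

/-- **`κ^∂_P ≤ κ_P`**: the gradient-partner profile is a restriction of the relative profile (so a seed on `κ_P` implies one
on `κ^∂_P`, never conversely). [cite: Martinelli1999, §2.4 p.103 (Def. 2.6)] -/
theorem kappaD_le_kappaP (m : ℕ) : kappaD 𝔖 P m ≤ kappaP 𝔖 P m :=
  csSup_le_csSup (profileSetP_bddAbove 𝔖 P m) (profileSetD_nonempty 𝔖 P m) (profileSetD_subset 𝔖 P m)

/-- Every child covariance with a frozen-direction gradient partner is bounded by `κ^∂_P(m)`.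
[cite: Martinelli1999, §2.4 p.103 (Def. 2.6); GlimmJaffe1987, Cor. 4.3.4 (proof)] -/
theorem abs_childCov_le_kappaD {lab : Fin n → Fin 3} {f f₁ f₂ : (Fin n → ℝ) → ℝ} {C : ℝ}
    (hD : 𝔖.SideData lab f f₁ f₂ C) {x : Fin n → ℝ} (hx : x ∈ cube n 𝔖.S) {j : Fin n} (hj : lab j = 1)
    (hPc : P (condPot lab 𝔖.lam f₁ x)) {m : ℕ} {F : (Fin n → ℝ) → ℝ} {A : Finset (Fin n)} (hF : 𝔖.Obs F A)
    (hA0 : ∀ i ∈ A, lab i = 0) (hA1 : ∀ i ∈ A, m + 𝔖.r < 𝔖.d i j) :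
    |cubeCov (condPot lab 𝔖.lam f₁ x) 𝔖.S (fun z => F (merge lab x z))
        (fun z => C⁻¹ * coordGradient f₁ (merge lab x z) j)| ≤ kappaD 𝔖 P m :=
  le_csSup (profileSetD_bddAbove 𝔖 P m)
    (Or.inr ⟨lab, f, f₁, f₂, C, x, j, F, A, hD, hx, hj, hPc, hF, hA0, hA1, rfl⟩)

/-- **`κ^∂_P(m)` is the LEAST bound of the child covariances with frozen-direction gradient partners** — the pointwise
form in which an in-situ estimate (Stein's identity with faces and Combes–Thomas for the affine part of the partner,
Brascamp–Lieb for its small remainder) would be supplied. [cite: Martinelli1999, §2.4 p.103 (Def. 2.6); GlimmJaffe1987, Cor. 4.3.4 (proof); BrascampLieb1976, Thm 4.1] -/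
theorem kappaD_le_of_forall {m : ℕ} {b : ℝ} (hb : 0 ≤ b)
    (h : ∀ (lab : Fin n → Fin 3) (f f₁ f₂ : (Fin n → ℝ) → ℝ) (C : ℝ) (x : Fin n → ℝ) (j : Fin n)
      (F : (Fin n → ℝ) → ℝ) (A : Finset (Fin n)),
      𝔖.SideData lab f f₁ f₂ C → x ∈ cube n 𝔖.S → lab j = 1 → P (condPot lab 𝔖.lam f₁ x) → 𝔖.Obs F A →
        (∀ i ∈ A, lab i = 0) → (∀ i ∈ A, m + 𝔖.r < 𝔖.d i j) →
        |cubeCov (condPot lab 𝔖.lam f₁ x) 𝔖.S (fun z => F (merge lab x z))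
            (fun z => C⁻¹ * coordGradient f₁ (merge lab x z) j)| ≤ b) :
    kappaD 𝔖 P m ≤ b := by
  refine csSup_le (profileSetD_nonempty 𝔖 P m) ?_
  rintro t (rfl | ⟨lab, f, f₁, f₂, C, x, j, F, A, hD, hx, hj, hPc, hF, hA0, hA1, rfl⟩)
  · exact hb
  · exact h lab f f₁ f₂ C x j F A hD hx hj hPc hF hA0 hA1

/-- `κ^∂_P` is monotone in `P`. [cite: Martinelli1999, §2.4 p.103 (Def. 2.6)] -/
theorem kappaD_mono {P Q : ((Fin n → ℝ) → ℝ) → Prop} (hPQ : ∀ f, P f → Q f) (m : ℕ) :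
    kappaD 𝔖 P m ≤ kappaD 𝔖 Q m :=
  kappaD_le_of_forall 𝔖 P (kappaD_nonneg 𝔖 Q m) fun _ _ _ _ _ _ _ _ _ hD hx hj hPc hF hA0 hA1 =>
    abs_childCov_le_kappaD 𝔖 Q hD hx hj (hPQ _ hPc) hF hA0 hA1

/-- `κ^∂_P` is non-increasing in the separation. [cite: Martinelli1999, §2.4 p.103 (Def. 2.6)] -/
theorem kappaD_antitone : Antitone (kappaD 𝔖 P) := fun m _ hmm' =>
  kappaD_le_of_forall 𝔖 P (kappaD_nonneg 𝔖 P m) fun _ _ _ _ _ _ _ _ _ hD hx hj hPc hF hA0 hA1 =>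
    abs_childCov_le_kappaD 𝔖 P hD hx hj hPc hF hA0 fun i hi => lt_of_le_of_lt (by omega) (hA1 i hi)

end ProfileD

/-! ## §2 The one-sided recursion bound and the STEP with `κ^∂_P` on the right: `κ_P(M) ≤ λ⁻¹ · N(m) · 2R² · κ^∂_P(m)²` -/

section StepD

variable (𝔖 : Spec n) (P : ((Fin n → ℝ) → ℝ) → Prop)

/-- **THE ONE-SIDED RECURSION BOUND WITH `κ^∂_P` (PROVED)**: along one-sided data with row constant `C`, for an insert `F`
supported in `A ⊆ inside` with `d(A, shell) > m + r`, if the conditional children satisfy `P`, every shell-indexed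
conditional covariance is `≤ C · κ^∂_P(m)` — by the DEFINITION of `κ^∂_P` and module IV's identification
`shellCov_grad_eq_cubeCov_condPot` (module VII's `side_bound`, sharpened from `κ` to exactly what it uses).
[cite: FriedliVelenik2017, Lemma 6.7 (6.7); FriedliVelenik2017, §6.10.1 (6.110); GlimmJaffe1987, Cor. 4.3.4 (proof); Martinelli1999, §2.4 p.103 (Def. 2.6)] -/
theorem side_boundD {lab : Fin n → Fin 3} {f f₁ f₂ : (Fin n → ℝ) → ℝ} {C : ℝ} (hD : 𝔖.SideData lab f f₁ f₂ C)
    {m : ℕ} {F : (Fin n → ℝ) → ℝ} {A : Finset (Fin n)} (hF : 𝔖.Obs F A) (hA0 : ∀ i ∈ A, lab i = 0)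
    (hA1 : ∀ j, lab j = 1 → ∀ i ∈ A, m + 𝔖.r < 𝔖.d i j)
    (hcl : ∀ x ∈ cube n 𝔖.S, P (condPot lab 𝔖.lam f₁ x)) :
    ∀ x ∈ cube n 𝔖.S, ∀ j, lab j = 1 →
      |shellCov lab f₁ 𝔖.S F (fun y => coordGradient f₁ y j) x| ≤ C * kappaD 𝔖 P m := by
  intro x hx j hj
  have hκ := abs_childCov_le_kappaD 𝔖 P hD hx hj (hcl x hx) hF hA0 (hA1 j hj)
  obtain ⟨hFc, -, hFd, -⟩ := hF
  have hC : C ≠ 0 := hD.C_pos.ne'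
  have hFd2 : DependsOn F {i | lab i ≠ 2} := hFd.mono fun i hi => by
    have h := hA0 i (Finset.mem_coe.mp hi)
    show lab i ≠ 2
    rw [h]; decide
  rw [shellCov_grad_eq_cubeCov_condPot 𝔖.S_pos lab 𝔖.lam (hD.cd₁.of_le (by norm_num)) hFc.continuous hD.dep₁
    hFd2 x j]
  have e : (fun z => coordGradient f₁ (merge lab x z) j)
      = fun z => C * (C⁻¹ * coordGradient f₁ (merge lab x z) j) := by
    funext z
    rw [← mul_assoc, mul_inv_cancel₀ hC, one_mul]
  rw [e, cubeCov_const_mul_right, abs_mul, abs_of_pos hD.C_pos]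
  exact mul_le_mul_of_nonneg_left hκ hD.C_pos.le

/-- **THE STEP FROM THE GRADIENT-PARTNER PROFILE (PROVED)**: for closed `P` and `M > 2m + 3r`,
`κ_P(M) ≤ λ⁻¹ · (a · G(m + 2r)) · 2R² · κ^∂_P(m)²` — the FULL relative profile at the coarse scale is controlled by the
GRADIENT-PARTNER profile at the fine scale (module VII's `kappa_step` ∕ module VIII's `kappaP_step` with `side_boundD`
on both sides).  [cite: BrascampLieb1976, Thm 4.1; FriedliVelenik2017, Exercise 3.11 (3.26); GlimmJaffe1987, Cor. 4.3.4 (proof); Martinelli1999, §2.4 p.103 (Def. 2.6, Thm 2.7); MartinelliOlivieri1994] -/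
theorem kappaP_stepD (hcl : CondClosed 𝔖 P) {m M : ℕ} (hM : 2 * m + 3 * 𝔖.r < M) :
    kappaP 𝔖 P M ≤ 𝔖.lam⁻¹ * ((𝔖.a * 𝔖.growth (m + 2 * 𝔖.r) : ℕ) : ℝ) * (2 * 𝔖.R ^ 2) * kappaD 𝔖 P m ^ 2 := by
  have hlam := 𝔖.lam_pos
  have hκ := kappaD_nonneg 𝔖 P m
  refine kappaP_le_of_forall 𝔖 P (by positivity) fun f F H hAdm hPf => ?_
  obtain ⟨hfC, A, B, hF, hH, hsep⟩ := hAdm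
  have hw : 𝔖.Wide (𝔖.rlab A m) := 𝔖.wide_rlab
  have hDlo := 𝔖.sideData_lo hfC hw
  have hDhi := 𝔖.sideData_hi hfC hw
  have hclo : ∀ x ∈ cube n 𝔖.S, P (condPot (𝔖.rlab A m) 𝔖.lam (fLo (𝔖.rlab A m) f) x) :=
    fun x hx => (hcl hw hfC hPf x hx).1
  have hchi : ∀ x ∈ cube n 𝔖.S, P (condPot (lswap (𝔖.rlab A m)) 𝔖.lam (fHi (𝔖.rlab A m) f) x) :=
    fun x hx => (hcl hw hfC hPf x hx).2
  have hβ := side_boundD 𝔖 P hDlo (m := m) hF (fun i hi => 𝔖.rlab_of_mem hi) (fun j hj => 𝔖.rlab_shell_far hj)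
    hclo
  have hγ' := side_boundD 𝔖 P hDhi (m := m) hH
    (fun k hk => (lswap_spec _ k).1.mpr (𝔖.rlab_of_sep hsep hM hk))
    (fun j hj => 𝔖.rlab_shell_far' hsep hM ((lswap_spec _ j).2.1.mp hj)) hchi
  have hγ : ∀ x ∈ cube n 𝔖.S, ∀ j, 𝔖.rlab A m j = 1 →
      |shellCov (𝔖.rlab A m) (fHi (𝔖.rlab A m) f) 𝔖.S H (fun y => coordGradient (fHi (𝔖.rlab A m) f) y j) x|
        ≤ 𝔖.R * kappaD 𝔖 P m := by
    intro x hx j hj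
    rw [← shellCov_lswap]
    exact hγ' x hx j ((lswap_spec _ j).2.1.mpr hj)
  have hB' : HessianBound (fLo (𝔖.rlab A m) f + fHi (𝔖.rlab A m) f) 𝔖.lam := by
    rw [fLo_add_fHi]; exact hfC.2.1
  have hFd : DependsOn F {i | 𝔖.rlab A m i = 0} :=
    hF.2.2.1.mono fun i hi => 𝔖.rlab_of_mem (Finset.mem_coe.mp hi)
  have hHd : DependsOn H {i | 𝔖.rlab A m i = 2} :=
    hH.2.2.1.mono fun k hk => 𝔖.rlab_of_sep hsep hM (Finset.mem_coe.mp hk)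
  have key := abs_cubeCov_le_doubling_profile 𝔖.S_pos 𝔖.lam_pos (𝔖.rlab A m) hDlo.cd₁ hDlo.cd₂ hB' hF.1 hH.1
    hDlo.dep₁ hFd hDlo.dep₂ hHd (κ₁ := kappaD 𝔖 P m) (κ₂ := kappaD 𝔖 P m) (C_F := 2 * 𝔖.R) (C_H := 𝔖.R) hκ hκ
    (by have := 𝔖.R_pos; positivity) 𝔖.R_pos.le hβ hγ
  rw [fLo_add_fHi] at key
  have hN : (((Finset.univ.filter fun j => 𝔖.rlab A m j = 1).card : ℕ) : ℝ)
      ≤ ((𝔖.a * 𝔖.growth (m + 2 * 𝔖.r) : ℕ) : ℝ) := by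
    have h1 := 𝔖.card_shell_le (A := A) (m := m)
    have h2 : A.card * 𝔖.growth (m + 2 * 𝔖.r) ≤ 𝔖.a * 𝔖.growth (m + 2 * 𝔖.r) :=
      Nat.mul_le_mul_right _ hF.2.2.2
    exact_mod_cast h1.trans h2
  have hR := 𝔖.R_pos
  calc |cubeCov f 𝔖.S F H|
      ≤ 𝔖.lam⁻¹ * ((Finset.univ.filter fun j => 𝔖.rlab A m j = 1).card : ℝ) * (2 * 𝔖.R * 𝔖.R)
          * (kappaD 𝔖 P m * kappaD 𝔖 P m) := key
    _ ≤ 𝔖.lam⁻¹ * ((𝔖.a * 𝔖.growth (m + 2 * 𝔖.r) : ℕ) : ℝ) * (2 * 𝔖.R * 𝔖.R)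
          * (kappaD 𝔖 P m * kappaD 𝔖 P m) := by gcongr
    _ = 𝔖.lam⁻¹ * ((𝔖.a * 𝔖.growth (m + 2 * 𝔖.r) : ℕ) : ℝ) * (2 * 𝔖.R ^ 2) * kappaD 𝔖 P m ^ 2 := by ring

end StepD

/-! ## §3 The barrier from ONE GRADIENT-PARTNER seed; the seed spelled out -/

section BarrierD

variable (𝔖 : Spec n) (P : ((Fin n → ℝ) → ℝ) → Prop)

/-- **THE BARRIER FROM A GRADIENT-PARTNER SEED (PROVED).**  For closed `P`, along `s_{j+1} = 2 s_j + 3r + 1` with geometric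
shell growth `a·G(s_j + 2r) ≤ A q^j`, ONE seed on the GRADIENT-PARTNER profile at ONE scale, `c A q κ^∂_P(s_0) ≤ ρ`
(`c = 2R²∕λ`), gives `κ^∂_P(s_j) ≤ ρ^{2^j} ∕ (c A q^{j+1})` at every scale: the recursion closes in `κ^∂_P` because
`κ^∂_P(s_{j+1}) ≤ κ_P(s_{j+1}) ≤ c A q^j κ^∂_P(s_j)²` (`kappaD_le_kappaP`, `kappaP_stepD`), and `sq_barrier` applies.
[cite: Martinelli1999, §2.4 p.103 (Def. 2.6, Thm 2.7); MartinelliOlivieri1994; HelfferSjostrand1994; Ledoux2001, Prop. 6.2 p.190] -/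
theorem kappaD_barrier (hcl : CondClosed 𝔖 P) (s : ℕ → ℕ) (hs : ∀ j, s (j + 1) = 2 * s j + 3 * 𝔖.r + 1)
    {A q ρ : ℝ} (hA : 0 < A) (hq : 0 < q) (hN : ∀ j, ((𝔖.a * 𝔖.growth (s j + 2 * 𝔖.r) : ℕ) : ℝ) ≤ A * q ^ j)
    (hseed : 𝔖.cst * A * q * kappaD 𝔖 P (s 0) ≤ ρ) :
    ∀ j, kappaD 𝔖 P (s j) ≤ ρ ^ 2 ^ j / (𝔖.cst * A * q ^ (j + 1)) := by
  have hc := 𝔖.cst_pos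
  set b : ℕ → ℝ := fun j => 𝔖.cst * A * q ^ (j + 1) * kappaD 𝔖 P (s j) with hb
  have hb0 : ∀ j, 0 ≤ b j := fun j => by
    have := kappaD_nonneg 𝔖 P (s j); simp only [hb]; positivity
  have hbstep : ∀ j, b (j + 1) ≤ b j ^ 2 := by
    intro j
    have hM : 2 * s j + 3 * 𝔖.r < s (j + 1) := by rw [hs j]; exact Nat.lt_succ_self _
    have h1 := (kappaD_le_kappaP 𝔖 P (s (j + 1))).trans (kappaP_stepD 𝔖 P hcl hM)
    have hκ := kappaD_nonneg 𝔖 P (s j)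
    have h2 : kappaD 𝔖 P (s (j + 1)) ≤ 𝔖.cst * (A * q ^ j) * kappaD 𝔖 P (s j) ^ 2 := by
      refine h1.trans ?_
      unfold Spec.cst
      have hlam := 𝔖.lam_pos
      have := hN j
      calc 𝔖.lam⁻¹ * ((𝔖.a * 𝔖.growth (s j + 2 * 𝔖.r) : ℕ) : ℝ) * (2 * 𝔖.R ^ 2) * kappaD 𝔖 P (s j) ^ 2
          ≤ 𝔖.lam⁻¹ * (A * q ^ j) * (2 * 𝔖.R ^ 2) * kappaD 𝔖 P (s j) ^ 2 := by gcongr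
        _ = 𝔖.lam⁻¹ * (2 * 𝔖.R ^ 2) * (A * q ^ j) * kappaD 𝔖 P (s j) ^ 2 := by ring
    simp only [hb]
    calc 𝔖.cst * A * q ^ (j + 1 + 1) * kappaD 𝔖 P (s (j + 1))
        ≤ 𝔖.cst * A * q ^ (j + 1 + 1) * (𝔖.cst * (A * q ^ j) * kappaD 𝔖 P (s j) ^ 2) := by
          have : 0 ≤ 𝔖.cst * A * q ^ (j + 1 + 1) := by positivity
          exact mul_le_mul_of_nonneg_left h2 this
      _ = (𝔖.cst * A * q ^ (j + 1) * kappaD 𝔖 P (s j)) ^ 2 := by ring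
  have hseed' : b 0 ≤ ρ := by simpa [hb] using hseed
  intro j
  have h := sq_barrier hb0 hbstep hseed' j
  simp only [hb] at h
  have hpos : 0 < 𝔖.cst * A * q ^ (j + 1) := by positivity
  rw [le_div_iff₀ hpos]
  calc kappaD 𝔖 P (s j) * (𝔖.cst * A * q ^ (j + 1)) = 𝔖.cst * A * q ^ (j + 1) * kappaD 𝔖 P (s j) := by ring
    _ ≤ ρ ^ 2 ^ j := h

/-- **THE FULL RELATIVE PROFILE FROM A GRADIENT-PARTNER SEED (PROVED)**: under the hypotheses of `kappaD_barrier`, from the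
FIRST DOUBLED SCALE on, `κ_P(s_{j+1}) ≤ ρ^{2^{j+1}} ∕ (c A q^{j+2})` — the same bound module VIII's `kappaP_barrier` gives from a
seed on `κ_P`, now from the WEAKER seed on `κ^∂_P` (only the scale `s_0` itself is not covered).
[cite: Martinelli1999, §2.4 p.103 (Def. 2.6, Thm 2.7); MartinelliOlivieri1994; HelfferSjostrand1994; Ledoux2001, Prop. 6.2 p.190] -/
theorem kappaP_barrier_of_gradSeed (hcl : CondClosed 𝔖 P) (s : ℕ → ℕ)
    (hs : ∀ j, s (j + 1) = 2 * s j + 3 * 𝔖.r + 1) {A q ρ : ℝ} (hA : 0 < A) (hq : 0 < q)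
    (hN : ∀ j, ((𝔖.a * 𝔖.growth (s j + 2 * 𝔖.r) : ℕ) : ℝ) ≤ A * q ^ j)
    (hseed : 𝔖.cst * A * q * kappaD 𝔖 P (s 0) ≤ ρ) :
    ∀ j, kappaP 𝔖 P (s (j + 1)) ≤ ρ ^ 2 ^ (j + 1) / (𝔖.cst * A * q ^ (j + 2)) := by
  intro j
  have hc := 𝔖.cst_pos
  have hlam := 𝔖.lam_pos
  have hM : 2 * s j + 3 * 𝔖.r < s (j + 1) := by rw [hs j]; exact Nat.lt_succ_self _
  have hκ := kappaD_nonneg 𝔖 P (s j)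
  have h1 := kappaP_stepD 𝔖 P hcl hM
  have h2 := kappaD_barrier 𝔖 P hcl s hs hA hq hN hseed j
  have hpos : 0 < 𝔖.cst * A * q ^ (j + 1) := by positivity
  have h3 : kappaD 𝔖 P (s j) ^ 2 ≤ (ρ ^ 2 ^ j / (𝔖.cst * A * q ^ (j + 1))) ^ 2 := pow_le_pow_left₀ hκ h2 2
  have e : (ρ ^ 2 ^ j) ^ 2 = ρ ^ 2 ^ (j + 1) := by rw [← pow_mul, pow_succ]
  calc kappaP 𝔖 P (s (j + 1))
      ≤ 𝔖.lam⁻¹ * ((𝔖.a * 𝔖.growth (s j + 2 * 𝔖.r) : ℕ) : ℝ) * (2 * 𝔖.R ^ 2) * kappaD 𝔖 P (s j) ^ 2 := h1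
    _ ≤ 𝔖.lam⁻¹ * (A * q ^ j) * (2 * 𝔖.R ^ 2) * (ρ ^ 2 ^ j / (𝔖.cst * A * q ^ (j + 1))) ^ 2 := by
        have := hN j
        gcongr
    _ = ρ ^ 2 ^ (j + 1) / (𝔖.cst * A * q ^ (j + 2)) := by
        rw [← e]
        unfold Spec.cst
        field_simp
        ring

/-- Read-out between scales from a gradient-partner seed: `κ_P(m) ≤ ρ^{2^{j+1}} ∕ (c A q^{j+2})` for every `m ≥ s_{j+1}`.
[cite: Martinelli1999, §2.4 p.103 (Def. 2.6, Thm 2.7); MartinelliOlivieri1994] -/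
theorem kappaP_barrier_of_gradSeed_of_le (hcl : CondClosed 𝔖 P) (s : ℕ → ℕ)
    (hs : ∀ j, s (j + 1) = 2 * s j + 3 * 𝔖.r + 1) {A q ρ : ℝ} (hA : 0 < A) (hq : 0 < q)
    (hN : ∀ j, ((𝔖.a * 𝔖.growth (s j + 2 * 𝔖.r) : ℕ) : ℝ) ≤ A * q ^ j)
    (hseed : 𝔖.cst * A * q * kappaD 𝔖 P (s 0) ≤ ρ) {j m : ℕ} (hm : s (j + 1) ≤ m) :
    kappaP 𝔖 P m ≤ ρ ^ 2 ^ (j + 1) / (𝔖.cst * A * q ^ (j + 2)) :=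
  (kappaP_antitone 𝔖 P hm).trans (kappaP_barrier_of_gradSeed 𝔖 P hcl s hs hA hq hN hseed j)

/-- **The gradient-partner seed, spelled out**: a POINTWISE bound `≤ ρ ∕ (c A q)` on the child covariances with
frozen-direction gradient partners at separation `s₀`, relative to `P`, is the seed `c A q κ^∂_P(s₀) ≤ ρ`.
[cite: Martinelli1999, §2.4 p.103 (Def. 2.6, Thm 2.7); GlimmJaffe1987, Cor. 4.3.4 (proof); BrascampLieb1976, Thm 4.1] -/
theorem kappaD_seed_of_forall {s₀ : ℕ} {A q ρ : ℝ} (hA : 0 < A) (hq : 0 < q) (hρ : 0 ≤ ρ)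
    (h : ∀ (lab : Fin n → Fin 3) (f f₁ f₂ : (Fin n → ℝ) → ℝ) (C : ℝ) (x : Fin n → ℝ) (j : Fin n)
      (F : (Fin n → ℝ) → ℝ) (B : Finset (Fin n)),
      𝔖.SideData lab f f₁ f₂ C → x ∈ cube n 𝔖.S → lab j = 1 → P (condPot lab 𝔖.lam f₁ x) → 𝔖.Obs F B →
        (∀ i ∈ B, lab i = 0) → (∀ i ∈ B, s₀ + 𝔖.r < 𝔖.d i j) →
        |cubeCov (condPot lab 𝔖.lam f₁ x) 𝔖.S (fun z => F (merge lab x z))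
            (fun z => C⁻¹ * coordGradient f₁ (merge lab x z) j)| ≤ ρ / (𝔖.cst * A * q)) :
    𝔖.cst * A * q * kappaD 𝔖 P s₀ ≤ ρ := by
  have hc := 𝔖.cst_pos
  have hpos : 0 < 𝔖.cst * A * q := by positivity
  have hk : kappaD 𝔖 P s₀ ≤ ρ / (𝔖.cst * A * q) := kappaD_le_of_forall 𝔖 P (div_nonneg hρ hpos.le) h
  calc 𝔖.cst * A * q * kappaD 𝔖 P s₀ ≤ 𝔖.cst * A * q * (ρ / (𝔖.cst * A * q)) :=
        mul_le_mul_of_nonneg_left hk hpos.le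
    _ = ρ := mul_div_cancel₀ ρ hpos.ne'

/-- A seed on the relative profile `κ_P` implies the (weaker) gradient-partner seed. [cite: Martinelli1999, §2.4 p.103 (Def. 2.6)] -/
theorem gradSeed_of_seed {s₀ : ℕ} {A q ρ : ℝ} (hA : 0 < A) (hq : 0 < q)
    (hseed : 𝔖.cst * A * q * kappaP 𝔖 P s₀ ≤ ρ) : 𝔖.cst * A * q * kappaD 𝔖 P s₀ ≤ ρ := by
  have hc := 𝔖.cst_pos
  have hpos : 0 ≤ 𝔖.cst * A * q := by positivity
  exact (mul_le_mul_of_nonneg_left (kappaD_le_kappaP 𝔖 P s₀) hpos).trans hseed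

end BarrierD

/-! ## §4 The in-situ read-out for ONE action from a gradient-partner seed (closed class ∕ near-Gaussian class) -/

section InSituD

variable (𝔖 : Spec n) (P : ((Fin n → ℝ) → ℝ) → Prop)

/-- **IN-SITU DECAY FOR ONE ACTION FROM A GRADIENT-PARTNER SEED (PROVED)**: `P` closed, `P f₀`; ONE seed
`c A q κ^∂_P(s_0) ≤ ρ` on the child covariances with frozen-direction gradient partners bounds every admissible covariance
OF `f₀` at separation `M ≥ s_{j+1}` by `ρ^{2^{j+1}} ∕ (c A q^{j+2})`.
[cite: Martinelli1999, §2.4 p.103 (Def. 2.6, Thm 2.7); MartinelliOlivieri1994; BrascampLieb1976, Thm 4.1; FriedliVelenik2017, Lemma 6.7 (6.7)–(6.10); GlimmJaffe1987, Cor. 4.3.4 (proof)] -/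
theorem abs_cubeCov_le_of_closed_gradSeed {f₀ : (Fin n → ℝ) → ℝ} (hcl : CondClosed 𝔖 P) (h₀ : P f₀) (s : ℕ → ℕ)
    (hs : ∀ j, s (j + 1) = 2 * s j + 3 * 𝔖.r + 1) {A q ρ : ℝ} (hA : 0 < A) (hq : 0 < q)
    (hN : ∀ j, ((𝔖.a * 𝔖.growth (s j + 2 * 𝔖.r) : ℕ) : ℝ) ≤ A * q ^ j)
    (hseed : 𝔖.cst * A * q * kappaD 𝔖 P (s 0) ≤ ρ) {j M : ℕ} (hM : s (j + 1) ≤ M) {F H : (Fin n → ℝ) → ℝ}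
    (hAdm : 𝔖.Adm M f₀ F H) : |cubeCov f₀ 𝔖.S F H| ≤ ρ ^ 2 ^ (j + 1) / (𝔖.cst * A * q ^ (j + 2)) :=
  (abs_cubeCov_le_kappaP 𝔖 P hAdm h₀).trans (kappaP_barrier_of_gradSeed_of_le 𝔖 P hcl s hs hA hq hN hseed hM)

/-- **… IN THE NEAR-GAUSSIAN CLASS**: for ONE action `f₀ ∈ 𝔐_ε`, a gradient-partner seed over `𝔐_ε` at ONE scale —
child potentials in `𝔐_ε`, partners the normalised frozen-direction partials (affine up to a gradient-remainder of size
`O(ε)` in this class), uniformly in the boundary field — bounds every admissible covariance of `f₀` at separation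
`≥ s_{j+1}`.  The seed is NOT proved here.
[cite: Martinelli1999, §2.4 p.103 (Def. 2.6, Thm 2.7); MartinelliOlivieri1994; BrascampLieb1976, Thm 4.1; Ledoux2001, Prop. 6.2 p.190; GlimmJaffe1987, Cor. 4.3.4 (proof)] -/
theorem abs_cubeCov_le_of_nearGauss_gradSeed {ε : ℝ} {f₀ : (Fin n → ℝ) → ℝ} (h₀ : NearGauss 𝔖 ε f₀) (s : ℕ → ℕ)
    (hs : ∀ j, s (j + 1) = 2 * s j + 3 * 𝔖.r + 1) {A q ρ : ℝ} (hA : 0 < A) (hq : 0 < q)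
    (hN : ∀ j, ((𝔖.a * 𝔖.growth (s j + 2 * 𝔖.r) : ℕ) : ℝ) ≤ A * q ^ j)
    (hseed : 𝔖.cst * A * q * kappaD 𝔖 (NearGauss 𝔖 ε) (s 0) ≤ ρ) {j M : ℕ} (hM : s (j + 1) ≤ M)
    {F H : (Fin n → ℝ) → ℝ} (hAdm : 𝔖.Adm M f₀ F H) :
    |cubeCov f₀ 𝔖.S F H| ≤ ρ ^ 2 ^ (j + 1) / (𝔖.cst * A * q ^ (j + 2)) :=
  abs_cubeCov_le_of_closed_gradSeed 𝔖 (NearGauss 𝔖 ε) (condClosed_nearGauss 𝔖 ε) h₀ s hs hA hq hN hseed hM hAdm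

end InSituD

end Literature.MathematicalPhysics.QuantumFieldTheory.Balaban1983to89.T4CubeShellGradPartner
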